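/-
Copyright (c) 2026. All rights reserved.
Released under Apache 2.0 license as described in the file LICENSE.
Authors: abc-iut cell, prover seat abc-iut-w5-d138 (wave 5, gen 4).
-/
import Literature.IUT.LogVolume.UnitLogWildPrime
import Literature.IUT.LogThetaLattice.LogLinkIteratesUnramified
import HarnessLib

/-!
# [IUTchIII] Rmk 1.1.1 (i): the domains of the log-link iterates — EMPTY from depth `2` for `e ≤ p − 1`, INHABITED AT EVERY DEPTH for `πᵖ = p ∈ k`

Proof-only companion (theorems, no definitions) of `LogLinkIteratesUnramified.lean` (abc-iut-w5-d138 gen 0: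
the abstract criterion `iterDomain_add_two_eq_empty_of_norm_log_lt_one` and the case `k = ℚ_p`) for the typed
domain `D_n` of the `n`-th iterate of the log-link (abc-iut-L6-t3/L6-d2, `iterDomain`: `D_0 = k`,
`D_{n+1} = {x ∈ 𝒪_k^× | log_k x ∈ D_n}`) at the standard model `PadicLogOnUnits.ofUnitLog p K`
(abc-iut-L4-t3 / abc-iut-S1: `log := log_p = unitLog`).  S. Mochizuki, *Inter-universal Teichmüller Theory III*,
kurims manuscript (May 2020), Rmk 1.1.1 (i) p. 28 ("iterates of the `log`-link … defined only on the [local]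
units"), Rmk 1.2.2 (iii) p. 37 [claim: Mochizuki2012, status: disputed; cited record-only].
A DICHOTOMY by absolute ramification, for a complete ultrametric normed `ℚ_p`-algebra field `K`:

* **`e(K/ℚ_p) ≤ p − 1`** (every `p`; all unramified `K`, `ℚ_p(ζ_p)`, …) **⇒ `D_{n+2} = ∅` for all `n`**
  (`iterDomain_ofUnitLog_add_two_eq_empty_of_absRamificationIdx_le`): abc-iut-w5-d172's
  `norm_unitLog_lt_one_of_absRamificationIdx_le` (`log_p(𝒪_K^×) ⊆ 𝔪_K`) fed into the gen-0 criterion — only the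
  FIRST iterate of the log-link has a nonempty domain at such places.
* **`πᵖ = p` for some `π ∈ K`, `p` odd** (e.g. `K ⊇ ℚ_p(p^{1/p})`; then `e ≥ p`) **⇒ `1 + π ∈ D_n` for EVERY
  `n`** (`one_add_pi_mem_iterDomain`, `iterDomain_ofUnitLog_nonempty`): the closed ball
  `B := {u : ‖u − (1 + π)‖ ≤ ‖π‖²}` of units is MAPPED INTO ITSELF by `log_p`
  (`norm_unitLog_sub_one_add_pi_le`, `mapsTo_unitLog_closedBall`): for `u = 1 + x ∈ B` one has `‖x‖ = ‖π‖`,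
  and in `log_p u = Σ_k (−1)^{k+1} xᵏ/k` the term `k = 1` is `x ≡ π`, the term `k = p` is
  `xᵖ/p = ((x/π)·π)ᵖ/p = (1 + t)ᵖ ≡ 1` modulo `‖π‖²` (`‖t‖ ≤ ‖π‖`; `(1+t)ᵖ = 1 + tᵖ + p·t·r`, Mathlib's
  `exists_add_pow_prime_eq`), and every other term has norm `≤ ‖π‖²` (`WildPrime.padicValNat_add_two_le`); so
  every iterate `log_p^{[n]}(1 + π)` lies in `B`, in particular is a unit whose logarithm is a unit, and NO
  iterate of the log-link has empty domain at such a place; for every odd `p` such a finite `E ⊆ ℚ̄_p`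
  exists (`exists_subfield_forall_iterDomain_nonempty`).

So the threshold `e ≤ p − 1` of the vacuity statement is SHARP at every odd prime, in the strongest sense (the
tree had the depth-`2` instance at `p = 3` only: abc-iut-w5-d172's `Cor312Ind3IteratesVacuityWild` over
`WildCubicUnitLogUnit`).  Classical `p`-adic analysis (Neukirch, *Algebraic Number Theory*, Ch. II (5.5));
nothing here bears on [IUTchIII] Cor. 3.12; no side taken.
-/

noncomputable section

open Metric Set
open scoped NormedField

namespace Literature.IUT.LogThetaLattice

open Literature.IUT.LogVolume Literature.AnabelianGeometry.AbsoluteAnabelian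

variable (p : ℕ) [hp : Fact p.Prime]
variable {K : Type*} [NontriviallyNormedField K] [instK : NormedAlgebra ℚ_[p] K] [IsUltrametricDist K]

/-! ### Small ramification: every iterate beyond the first has empty domain -/

/-- **IUTchIII:Rmk1.1.1(i)** (kurims p.28) at a place with `e(K/ℚ_p) ≤ p − 1` (every prime `p`): the second and
all higher iterates of the log-link on the units of `K` have EMPTY domain, `D_{n+2} = ∅` for the standard model
`ofUnitLog p K` — since `log_p(𝒪_K^×) ⊆ 𝔪_K` contains no unit (abc-iut-w5-d172). [claim: Mochizuki2012, status: disputed] -/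
theorem iterDomain_ofUnitLog_add_two_eq_empty_of_absRamificationIdx_le [ProperSpace K]
    (he : absRamificationIdx p K ≤ p - 1) (n : ℕ) :
    iterDomain (PadicLogOnUnits.ofUnitLog p K) (n + 2) = ∅ :=
  iterDomain_add_two_eq_empty_of_norm_log_lt_one _
    (fun x _ => by
      rw [PadicLogOnUnits.ofUnitLog_log]
      exact norm_unitLog_lt_one_of_absRamificationIdx_le p he x) n

/-- … in particular the SECOND iterate: `D_2 = ∅` when `e ≤ p − 1`. [claim: Mochizuki2012, status: disputed] -/
theorem iterDomain_ofUnitLog_two_eq_empty_of_absRamificationIdx_le [ProperSpace K]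
    (he : absRamificationIdx p K ≤ p - 1) :
    iterDomain (PadicLogOnUnits.ofUnitLog p K) 2 = ∅ :=
  iterDomain_ofUnitLog_add_two_eq_empty_of_absRamificationIdx_le p he 0

/-- … and every image `log^{[n+2]}(D_{n+2})` is empty there. [claim: Mochizuki2012, status: disputed] -/
theorem iterate_image_ofUnitLog_eq_empty_of_absRamificationIdx_le [ProperSpace K]
    (he : absRamificationIdx p K ≤ p - 1) (n : ℕ) :
    ((PadicLogOnUnits.ofUnitLog p K).log^[n + 2]) '' iterDomain (PadicLogOnUnits.ofUnitLog p K) (n + 2) = ∅ := by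
  rw [iterDomain_ofUnitLog_add_two_eq_empty_of_absRamificationIdx_le p he n, image_empty]

/-! ### Wild ramification `πᵖ = p`: the ball `‖u − (1 + π)‖ ≤ ‖π‖²` is `log_p`-stable -/

section Wild

variable {p} {π : K}

omit instK in
/-- **Frobenius congruence**: for `‖t‖ ≤ 1`, `‖(1 + t)ᵖ − 1‖ ≤ max (‖p‖·‖t‖) (‖t‖ᵖ)`
(`(1 + t)ᵖ = 1 + tᵖ + p·t·r` with `‖r‖ ≤ 1`, Mathlib's `exists_add_pow_prime_eq` in the valuation ring).
[cite: NeukirchANT1999, Ch. II (5.5)] -/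
theorem norm_one_add_pow_prime_sub_one_le {t : K} (ht : ‖t‖ ≤ 1) :
    ‖(1 + t) ^ p - 1‖ ≤ max (‖(p : K)‖ * ‖t‖) (‖t‖ ^ p) := by
  set T : Valued.integer K := ⟨t, Valued.integer.mem_iff.mpr ht⟩ with hT
  obtain ⟨r, hr⟩ := exists_add_pow_prime_eq hp.out (1 : Valued.integer K) T
  have hr' : ((1 : K) + t) ^ p = 1 + t ^ p + (p : K) * 1 * t * (r : K) := by
    have := congrArg (fun z : Valued.integer K ↦ (z : K)) hr
    simpa [hT] using this
  have hrn : ‖(r : K)‖ ≤ 1 := Valued.integer.norm_le_one r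
  rw [hr', show (1 : K) + t ^ p + (p : K) * 1 * t * (r : K) - 1 = (p : K) * t * (r : K) + t ^ p by ring]
  refine (IsUltrametricDist.norm_add_le_max _ _).trans (max_le_max ?_ (norm_pow_le t p))
  rw [norm_mul, norm_mul]
  calc ‖(p : K)‖ * ‖t‖ * ‖(r : K)‖ ≤ ‖(p : K)‖ * ‖t‖ * 1 := by gcongr
    _ = ‖(p : K)‖ * ‖t‖ := mul_one _

omit [IsUltrametricDist K] in
/-- `π ≠ 0`. [cite: NeukirchANT1999, Ch. II (5.5)] -/
theorem pi_ne_zero (hπ : π ^ p = p) : π ≠ 0 := by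
  rintro rfl
  rw [zero_pow hp.out.ne_zero] at hπ
  exact prime_ne_zero p K hπ.symm

omit [IsUltrametricDist K] in
/-- `0 < ‖π‖`. [cite: NeukirchANT1999, Ch. II (5.5)] -/
theorem norm_pi_pos (hπ : π ^ p = p) : 0 < ‖π‖ := norm_pos_iff.mpr (pi_ne_zero hπ)

/-- On the ball `‖x − π‖ ≤ ‖π‖²` the norm is constant: `‖x‖ = ‖π‖`. [cite: NeukirchANT1999, Ch. II (5.5)] -/
theorem norm_eq_norm_pi_of_norm_sub_le (hπ : π ^ p = p) {x : K} (hx : ‖x - π‖ ≤ ‖π‖ ^ 2) : ‖x‖ = ‖π‖ := by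
  have hr1 : ‖π‖ < 1 := WildPrime.norm_pi_lt_one hπ
  have hr0 : 0 < ‖π‖ := norm_pi_pos hπ
  have hlt : ‖x - π‖ < ‖π‖ := by
    refine hx.trans_lt ?_
    calc ‖π‖ ^ 2 = ‖π‖ * ‖π‖ := sq _
      _ < 1 * ‖π‖ := by gcongr
      _ = ‖π‖ := one_mul _
  have hne : ‖π‖ ≠ ‖x - π‖ := (ne_of_lt hlt).symm
  rw [show x = π + (x - π) by ring, IsUltrametricDist.norm_add_eq_max_of_norm_ne_norm hne]
  exact max_eq_left hlt.le

/-- **The `p`-th term is `≡ 1`**: for `‖x − π‖ ≤ ‖π‖²`, `‖xᵖ/p − 1‖ ≤ ‖π‖²` — write `x = π(1 + t)` with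
`‖t‖ ≤ ‖π‖`, so `xᵖ/p = (1 + t)ᵖ` and `‖(1 + t)ᵖ − 1‖ ≤ max (p⁻¹‖π‖) (‖π‖ᵖ) ≤ ‖π‖²`.
[cite: NeukirchANT1999, Ch. II (5.5)] -/
theorem norm_pow_prime_div_sub_one_le (hπ : π ^ p = p) {x : K} (hx : ‖x - π‖ ≤ ‖π‖ ^ 2) :
    ‖x ^ p / (p : K) - 1‖ ≤ ‖π‖ ^ 2 := by
  have hπ0 : π ≠ 0 := pi_ne_zero hπ
  have hp0 : (p : K) ≠ 0 := prime_ne_zero p K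
  have hr0 : 0 < ‖π‖ := norm_pi_pos hπ
  have hr1 : ‖π‖ < 1 := WildPrime.norm_pi_lt_one hπ
  have h2p : 2 ≤ p := hp.out.two_le
  -- `x = π (1 + t)`, `t = (x - π)/π`, `‖t‖ ≤ ‖π‖`
  set t : K := (x - π) / π with ht
  have hxt : x = π * (1 + t) := by rw [ht]; field_simp; ring
  have htn : ‖t‖ ≤ ‖π‖ := by
    rw [ht, norm_div, div_le_iff₀ hr0, ← sq]
    exact hx
  have ht1 : ‖t‖ ≤ 1 := htn.trans hr1.le
  have hxp : x ^ p / (p : K) = (1 + t) ^ p := by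
    rw [hxt, mul_pow, hπ, mul_div_cancel_left₀ _ hp0]
  rw [hxp]
  refine (norm_one_add_pow_prime_sub_one_le ht1).trans (max_le ?_ ?_)
  · -- `p⁻¹ · ‖t‖ ≤ ‖π‖ᵖ · ‖π‖ ≤ ‖π‖²`
    rw [norm_prime p K, ← WildPrime.norm_pi_pow hπ]
    calc ‖π‖ ^ p * ‖t‖ ≤ ‖π‖ ^ 1 * ‖π‖ :=
          mul_le_mul (pow_le_pow_of_le_one hr0.le hr1.le hp.out.one_le) htn (norm_nonneg _)
            (by positivity)
      _ = ‖π‖ ^ 2 := by ring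
  · calc ‖t‖ ^ p ≤ ‖π‖ ^ p := by gcongr
      _ ≤ ‖π‖ ^ 2 := pow_le_pow_of_le_one hr0.le hr1.le h2p

omit [IsUltrametricDist K] in
/-- **The other terms are `O(π²)`**: for `‖x‖ = ‖π‖` and an index `n + 1 ∉ {1, p}`, the `n`-th term of the
logarithmic series at `1 + x` has norm `≤ ‖π‖²` (`p ∤ n+1`: `‖π‖^{n+1} ≤ ‖π‖²`; `n + 1 = pm`, `m ≥ 2`:
`p^{v_p(m)+1−m} ≤ p⁻¹ = ‖π‖ᵖ ≤ ‖π‖²`, by `WildPrime.padicValNat_add_two_le`, `p ≠ 2`).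
[cite: NeukirchANT1999, Ch. II (5.5)] -/
theorem norm_logTerm_le_sq_of_ne (hp2 : p ≠ 2) (hπ : π ^ p = p) {x : K} (hxn : ‖x‖ = ‖π‖) {n : ℕ}
    (hn1 : n + 1 ≠ 1) (hnp : n + 1 ≠ p) :
    ‖-((1 - (1 + x)) ^ (n + 1)) / (n + 1 : K)‖ ≤ ‖π‖ ^ 2 := by
  rw [WildPrime.norm_logTerm_eq p x n, hxn]
  have hπ0 : 0 ≤ ‖π‖ := norm_nonneg π
  have hπ1 : ‖π‖ ≤ 1 := (WildPrime.norm_pi_lt_one hπ).le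
  have hp1 : (1 : ℝ) ≤ p := by exact_mod_cast hp.out.one_le
  have hp0 : (0 : ℝ) < p := by exact_mod_cast hp.out.pos
  by_cases hdvd : p ∣ n + 1
  · obtain ⟨m, hm⟩ := hdvd
    have hm0 : m ≠ 0 := by rintro rfl; simp at hm
    have hm1 : m ≠ 1 := by rintro rfl; rw [mul_one] at hm; exact hnp hm
    have hm2 : 2 ≤ m := by omega
    have hval : padicValNat p (n + 1) = padicValNat p m + 1 := by
      rw [hm, padicValNat.mul hp.out.ne_zero hm0, padicValNat_self, add_comm]
    have hkey := WildPrime.padicValNat_add_two_le hp2 hm2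
    rw [hval, hm, pow_mul, WildPrime.norm_pi_pow hπ, inv_pow]
    calc ((p : ℝ) ^ m)⁻¹ * (p : ℝ) ^ (padicValNat p m + 1)
        ≤ ((p : ℝ) ^ m)⁻¹ * (p : ℝ) ^ (m - 1) :=
          mul_le_mul_of_nonneg_left (pow_le_pow_right₀ hp1 (by omega)) (by positivity)
      _ = (p : ℝ)⁻¹ := by
          have hpm : (p : ℝ) ^ m = (p : ℝ) ^ (m - 1) * p := by
            rw [← pow_succ, Nat.sub_add_cancel (by omega : 1 ≤ m)]
          rw [hpm, mul_inv, mul_assoc, mul_comm (p : ℝ)⁻¹, ← mul_assoc,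
            inv_mul_cancel₀ (pow_ne_zero _ hp0.ne'), one_mul]
      _ = ‖π‖ ^ p := (WildPrime.norm_pi_pow hπ).symm
      _ ≤ ‖π‖ ^ 2 := pow_le_pow_of_le_one hπ0 hπ1 hp.out.two_le
  · rw [padicValNat.eq_zero_of_not_dvd hdvd, pow_zero, mul_one]
    exact pow_le_pow_of_le_one hπ0 hπ1 (by omega)

/-- Points of the ball are units: `‖u − (1 + π)‖ ≤ ‖π‖² ⇒ ‖u‖ = 1`. [cite: NeukirchANT1999, Ch. II (5.5)] -/
theorem norm_eq_one_of_norm_sub_one_add_pi_le (hπ : π ^ p = p) {u : K} (hu : ‖u - (1 + π)‖ ≤ ‖π‖ ^ 2) :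
    ‖u‖ = 1 := by
  have hxn : ‖u - 1‖ = ‖π‖ :=
    norm_eq_norm_pi_of_norm_sub_le hπ (by rw [show u - 1 - π = u - (1 + π) by ring]; exact hu)
  have h : IsPrincipal u := by
    show ‖1 - u‖ < 1
    rw [norm_sub_rev, hxn]; exact WildPrime.norm_pi_lt_one hπ
  exact h.norm_eq_one

variable [CompleteSpace K]

/-- **The ball `B = {‖u − (1 + π)‖ ≤ ‖π‖²}` is `log_p`-stable** (`p` odd, `πᵖ = p`): for `u ∈ B`,
`‖log_p u − (1 + π)‖ ≤ ‖π‖²`.  Proof: `u = 1 + x`, `‖x − π‖ ≤ ‖π‖²`, `‖x‖ = ‖π‖`; `log_p u = Σ_n f_n`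
(`hasSum_unitLog`) with `f_0 = x ≡ π`, `f_{p−1} = xᵖ/p ≡ 1`, and `‖f_n‖ ≤ ‖π‖²` otherwise; the ultrametric
inequality bounds the doubly punctured series by `‖π‖²`. [cite: NeukirchANT1999, Ch. II (5.5)] -/
theorem norm_unitLog_sub_one_add_pi_le (hp2 : p ≠ 2) (hπ : π ^ p = p) {u : K}
    (hu : ‖u - (1 + π)‖ ≤ ‖π‖ ^ 2) : ‖unitLog u - (1 + π)‖ ≤ ‖π‖ ^ 2 := by
  classical
  have hodd : Odd p := hp.out.odd_of_ne_two hp2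
  have hp3 : 3 ≤ p := by have := hp.out.two_le; omega
  have hp0 : (p : K) ≠ 0 := prime_ne_zero p K
  set x : K := u - 1 with hxdef
  have hux : u = 1 + x := by rw [hxdef]; ring
  have hxπ : ‖x - π‖ ≤ ‖π‖ ^ 2 := by rw [hxdef, show u - 1 - π = u - (1 + π) by ring]; exact hu
  have hxn : ‖x‖ = ‖π‖ := norm_eq_norm_pi_of_norm_sub_le hπ hxπ
  have hprinc : IsPrincipal u := by
    show ‖1 - u‖ < 1
    rw [hux, show (1 : K) - (1 + x) = -x by ring, norm_neg, hxn]
    exact WildPrime.norm_pi_lt_one hπ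
  -- the series
  set f : ℕ → K := fun n ↦ -((1 - u) ^ (n + 1)) / (n + 1 : K) with hf
  have hsum : HasSum f (unitLog u) := hasSum_unitLog p hprinc
  have hf0 : f 0 = x := by
    simp only [hf, hux, Nat.cast_zero, zero_add, pow_one, div_one]
    ring
  have hfp : f (p - 1) = x ^ p / (p : K) := by
    simp only [hf, hux]
    rw [show ((p - 1 : ℕ) : K) + 1 = (p : K) by
          norm_cast; rw [Nat.sub_add_cancel hp.out.one_le],
      Nat.sub_add_cancel hp.out.one_le, show (1 : K) - (1 + x) = -x by ring, hodd.neg_pow, neg_neg]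
  -- puncture the series at `0` and at `p - 1`
  have h1 : HasSum (fun n ↦ if n = 0 then 0 else f n) (unitLog u - f 0) := hasSum_ite_sub_hasSum hsum 0
  have h2 : HasSum (fun n ↦ if n = p - 1 then 0 else (if n = 0 then 0 else f n))
      (unitLog u - f 0 - f (p - 1)) := by
    have := hasSum_ite_sub_hasSum h1 (p - 1)
    rwa [if_neg (by omega : p - 1 ≠ 0)] at this
  have hrest : ‖unitLog u - f 0 - f (p - 1)‖ ≤ ‖π‖ ^ 2 := by
    rw [← h2.tsum_eq]
    refine IsUltrametricDist.norm_tsum_le_of_forall_le_of_nonneg (sq_nonneg _) fun n ↦ ?_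
    by_cases hnp : n = p - 1
    · rw [if_pos hnp, norm_zero]; exact sq_nonneg _
    rw [if_neg hnp]
    by_cases hn0 : n = 0
    · rw [if_pos hn0, norm_zero]; exact sq_nonneg _
    rw [if_neg hn0, hf, hux]
    exact norm_logTerm_le_sq_of_ne hp2 hπ hxn (by omega) (by omega)
  -- assemble: `log u − (1 + π) = (log u − f₀ − f_{p−1}) + (f₀ − π) + (f_{p−1} − 1)`
  have hsplit : unitLog u - (1 + π) =
      (unitLog u - f 0 - f (p - 1)) + ((f 0 - π) + (f (p - 1) - 1)) := by ring
  rw [hsplit]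
  refine (IsUltrametricDist.norm_add_le_max _ _).trans (max_le hrest ?_)
  refine (IsUltrametricDist.norm_add_le_max _ _).trans (max_le ?_ ?_)
  · rw [hf0]; exact hxπ
  · rw [hfp]; exact norm_pow_prime_div_sub_one_le hπ hxπ

/-- `log_p` maps the closed ball `closedBall (1 + π) (‖π‖²)` into itself.
[cite: NeukirchANT1999, Ch. II (5.5)] -/
theorem mapsTo_unitLog_closedBall (hp2 : p ≠ 2) (hπ : π ^ p = p) :
    MapsTo (unitLog : K → K) (closedBall (1 + π) (‖π‖ ^ 2)) (closedBall (1 + π) (‖π‖ ^ 2)) := by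
  intro u hu
  rw [mem_closedBall, dist_eq_norm] at hu ⊢
  exact norm_unitLog_sub_one_add_pi_le hp2 hπ hu

/-- Hence EVERY iterate `log_p^{[n]} u` of a point `u` of the ball stays in the ball.
[cite: NeukirchANT1999, Ch. II (5.5)] -/
theorem norm_iterate_unitLog_sub_one_add_pi_le (hp2 : p ≠ 2) (hπ : π ^ p = p) {u : K}
    (hu : ‖u - (1 + π)‖ ≤ ‖π‖ ^ 2) (n : ℕ) : ‖unitLog^[n] u - (1 + π)‖ ≤ ‖π‖ ^ 2 := by
  induction n with
  | zero => simpa using hu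
  | succ n ih =>
    rw [Function.iterate_succ_apply']
    exact norm_unitLog_sub_one_add_pi_le hp2 hπ ih

/-- **Every iterate of `log_p` at `1 + π` is a unit** (`p` odd, `πᵖ = p`): `‖log_p^{[n]}(1 + π)‖ = 1` for all
`n`. [cite: NeukirchANT1999, Ch. II (5.5)] -/
theorem norm_iterate_unitLog_one_add_pi (hp2 : p ≠ 2) (hπ : π ^ p = p) (n : ℕ) :
    ‖unitLog^[n] (1 + π)‖ = 1 :=
  norm_eq_one_of_norm_sub_one_add_pi_le hπ
    (norm_iterate_unitLog_sub_one_add_pi_le hp2 hπ (by simp) n)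

/-! ### … so every iterate of the log-link has inhabited domain -/

/-- **IUTchIII:Rmk1.1.1(i)** (kurims p.28) Every point of the ball `‖u − (1 + π)‖ ≤ ‖π‖²` lies in the domain `D_n`
of the `n`-th iterate of the log-link, for EVERY `n` (standard model `ofUnitLog p K`; `p` odd, `πᵖ = p`).
[claim: Mochizuki2012, status: disputed] -/
theorem mem_iterDomain_of_norm_sub_one_add_pi_le (hp2 : p ≠ 2) (hπ : π ^ p = p) (n : ℕ) :
    ∀ {u : K}, ‖u - (1 + π)‖ ≤ ‖π‖ ^ 2 → u ∈ iterDomain (PadicLogOnUnits.ofUnitLog p K) n := by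
  induction n with
  | zero => intro u _; simp
  | succ n ih =>
    intro u hu
    rw [mem_iterDomain_succ, PadicLogOnUnits.ofUnitLog_log]
    exact ⟨mem_sphere_zero_iff_norm.mpr (norm_eq_one_of_norm_sub_one_add_pi_le hπ hu),
      ih (norm_unitLog_sub_one_add_pi_le hp2 hπ hu)⟩

/-- **IUTchIII:Rmk1.1.1(i)** (kurims p.28) **`1 + π ∈ D_n` for every `n`**: at a place containing a `p`-th root `π`
of `p` (`p` odd) the unit `1 + π` survives EVERY iterate of the log-link. [claim: Mochizuki2012, status: disputed] -/
theorem one_add_pi_mem_iterDomain (hp2 : p ≠ 2) (hπ : π ^ p = p) (n : ℕ) :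
    1 + π ∈ iterDomain (PadicLogOnUnits.ofUnitLog p K) n :=
  mem_iterDomain_of_norm_sub_one_add_pi_le hp2 hπ n (by simp)

/-- **IUTchIII:Rmk1.1.1(i)** (kurims p.28) … hence NO iterate of the log-link has empty domain there: `D_n ≠ ∅`
for all `n` (contrast: `D_n = ∅` for `n ≥ 2` whenever `e ≤ p − 1`). [claim: Mochizuki2012, status: disputed] -/
theorem iterDomain_ofUnitLog_nonempty (hp2 : p ≠ 2) (hπ : π ^ p = p) (n : ℕ) :
    (iterDomain (PadicLogOnUnits.ofUnitLog p K) n).Nonempty :=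
  ⟨1 + π, one_add_pi_mem_iterDomain hp2 hπ n⟩

/-- … and every iterate image `log^{[n]}(D_n)` is inhabited (by `log_p^{[n]}(1 + π)`).
[claim: Mochizuki2012, status: disputed] -/
theorem iterate_image_ofUnitLog_nonempty (hp2 : p ≠ 2) (hπ : π ^ p = p) (n : ℕ) :
    (((PadicLogOnUnits.ofUnitLog p K).log^[n]) '' iterDomain (PadicLogOnUnits.ofUnitLog p K) n).Nonempty :=
  (iterDomain_ofUnitLog_nonempty hp2 hπ n).image _

/-- The whole ball lies in every `D_n`: `closedBall (1 + π) (‖π‖²) ⊆ D_n`. [claim: Mochizuki2012, status: disputed] -/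
theorem closedBall_subset_iterDomain (hp2 : p ≠ 2) (hπ : π ^ p = p) (n : ℕ) :
    closedBall (1 + π) (‖π‖ ^ 2) ⊆ iterDomain (PadicLogOnUnits.ofUnitLog p K) n := by
  intro u hu
  rw [mem_closedBall, dist_eq_norm] at hu
  exact mem_iterDomain_of_norm_sub_one_add_pi_le hp2 hπ n hu

end Wild

/-! ### Non-vacuity: for every odd `p` a finite `E ⊆ ℚ̄_p` at which no iterate is empty -/

/-- **For every odd prime `p` there is a finite extension `E ⊆ ℚ̄_p` of `ℚ_p` (namely `ℚ_p(p^{1/p})`, `p ≤ e`) at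
which EVERY iterate of the log-link has inhabited domain** — so the restriction `e ≤ p − 1` in
`iterDomain_ofUnitLog_add_two_eq_empty_of_absRamificationIdx_le` cannot be dropped at any odd `p`.
[claim: Mochizuki2012, status: disputed] -/
theorem exists_subfield_forall_iterDomain_nonempty (hp2 : p ≠ 2) :
    ∃ (E : IntermediateField ℚ_[p] (PadicAlgCl p)) (_ : FiniteDimensional ℚ_[p] E),
      (∀ n : ℕ, (iterDomain (PadicLogOnUnits.ofUnitLog p E) n).Nonempty) ∧ p ≤ absRamificationIdx p E := by
  obtain ⟨E, hfd, π, hπ⟩ := WildPrime.exists_subfield_pow_prime_eq p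
  haveI : ProperSpace E := properSpace_subfield p E
  exact ⟨E, hfd, fun n => iterDomain_ofUnitLog_nonempty hp2 hπ n,
    WildPrime.prime_le_absRamificationIdx hp2 hπ⟩

end Literature.IUT.LogThetaLattice

end
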